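import Summits.ResolutionOfSingularities.ResolutionOfSingularities.Theorems.HomologicalConductorNoZenoRMinimalOfFirstKindImage
import Summits.ResolutionOfSingularities.ResolutionOfSingularities.Theorems.HomologicalConductorNoZenoRRelativelyMinimalCriterion
import Summits.ResolutionOfSingularities.ResolutionOfSingularities.Theorems.HomologicalConductorNoZenoNewCurvesContracted
import Summits.ResolutionOfSingularities.ResolutionOfSingularities.Theorems.HomologicalConductorNoZenoNodeCurveRegular
import Summits.ResolutionOfSingularities.ResolutionOfSingularities.Theorems.HomologicalConductorNoZenoRLipman131Rational
import Summits.ResolutionOfSingularities.ResolutionOfSingularities.Theorems.HomologicalConductorNoZenoExcCurveLift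
import Literature.AlgebraicGeometry.Resolution.Lipman1969ProperTransformHolds
import Literature.AlgebraicGeometry.Resolution.ExceptionalFibreConnected
import HarnessLib

/-!
# Crux `NoZenoR` (stmt-ResolutionOfSingularities-19943) — THE MINIMAL DESINGULARIZATION OF A RATIONAL SURFACE SINGULARITY
# EXISTS, from Lipman (27.1) alone: the consumed form of the W3 print `Lipman1969_4_1` follows from `Lipman1969_27_1_reg_rat`

Route `ResolutionOfSingularities/HomologicalConductor` (cell decomp-res, hand leafhand-res-homologicalconduct-16 g3, on bricks of
hands 16 g3 / 18 g1 and of the res-L0-w44 lineage).  OURS: AI-written proof over tree theorems, weaker than expert review;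
nothing here is a statement of the manuscript under review (Hironaka 2017).  SUPPORT level, counted 0.  Def-free, no new
named facts.

The print `Lipman1969_4_1` (minimal desingularization of a normal surface with finitely many rational singularities) enters
the `NoZenoR` chain ONLY through `Lipman1969_4_1.exists_isMinimalResolution_Spec` («`Spec S` has a minimal desingularization»
for a two-dimensional Noetherian local normal domain `S` with a rational singularity; all 17 uses).  This file proves that
consumed form from `Lipman1969_27_1_reg_rat` alone:

* `descent_of_27_1` — the one-blow-up descent (D) of `…NoZenoRMinimalOfDescent` for a RELATIVELY MINIMAL candidate, under
  (27.1): the exceptional curve `E = cl{ε}` of the blow-up `τ : Z' → Z₁` is a REGULAR first-kind curve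
  (`PointBlowup.not_stalkIdeal_primeDivisorIdeal_le_sq`, `PointBlowup.h0_comap_vanishingIdeal_point_sq_eq_three_mul`); if
  `h : Z' → X_r` mapped `ε` to an exceptional-curve point of `X_r`, that curve would satisfy (M) (relatively minimal +
  (27.1): `FirstKind.criterionM_of_forall_isIso`), contradicting `ExcCount.false_of_firstKind_of_three_mul_h0_lt`
  (res-L0-w44 lead: Case A + normality + constant fields; prints (13.1) d), (15) a) are tree theorems); so `h ε` is a
  closed point, `h` is constant on `τ⁻¹(z₁)` and the rigidity `exists_fac_of_forall_base_eq` (D1) descends `h`;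
* `exists_isMinimalResolution_of_27_1` — **a rational `S` has a minimal desingularization, from (27.1)**
  (`exists_isMinimalResolution_of_descent_of_hasRationalSingularity`);
* `Lipman1969_27_3_rat_of_27_1` — hence **`Lipman1969_27_3_rat.{0}` follows from `Lipman1969_27_1_reg_rat.{0}` ALONE**
  (hand 18 g1's `Lipman1969_27_3_rat_of_27_1_of_exists_minimal`).

Consequence for the by-name stub `stub_publishedSurfaceFactsW3`: its text stays equivalent to the six prints (it CONTAINS
`Lipman1969_4_1` verbatim), but the print `Lipman1969_4_1` is now IDLE for the chain given `Lipman1969_27_1_reg_rat`.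
No crux or summit statement is proved here.
-/

noncomputable section

-- single-problem summit: the doubled namespace component `ResolutionOfSingularities` is forced
set_option linter.dupNamespace false

open CategoryTheory AlgebraicGeometry TopologicalSpace Topology IsLocalRing
open Literature.AlgebraicGeometry.Resolution Scheme.IdealSheafData

namespace Summit.ResolutionOfSingularities.ResolutionOfSingularities.Theorems.NoZeno.ExcCount.FirstKind

variable {S : Type} [CommRing S] [IsNoetherianRing S] [IsLocalRing S] [IsDomain S] [IsIntegrallyClosed S]

/-- **The one-blow-up descent (D) for a relatively minimal candidate, under Lipman (27.1).**  `S` a two-dimensional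
Noetherian local normal domain with a rational singularity, `π_r : X_r → Spec S` a RELATIVELY MINIMAL desingularization
(every `S`-morphism from `X_r` to a desingularization is an isomorphism); then every `S`-morphism `h : Z' → X_r` from the
blowing up `τ : Z' → Z₁` of a closed point `z₁` (`dim 𝒪_{Z₁,z₁} = 2`) of a desingularization `g₁` descends to `Z₁ → X_r`.
The exceptional curve of `τ` is a regular first-kind curve; were its image a curve of `X_r`, that curve would satisfy
(M) ((27.1)), which `ExcCount.false_of_firstKind_of_three_mul_h0_lt` forbids; so the image is a point and the rigidity
(D1) applies. [cite: Lipman1969, Theorem (4.1) (p. 204); Corollary (27.3), proof (pp. 277–278)] -/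
theorem descent_of_27_1 (h271 : Lipman1969_27_1_reg_rat.{0}) (h2 : ringKrullDim S = 2)
    (hS : HasRationalSingularity S) {Xr : Scheme.{0}} {πr : Xr ⟶ Spec (.of S)} (hπr : IsResolution πr)
    (hrel : ∀ (X' : Scheme.{0}) (f' : X' ⟶ Spec (.of S)) (k' : Xr ⟶ X'), IsResolution f' → k' ≫ f' = πr →
      IsIso k') :
    ∀ (Z₁ Z' : Scheme.{0}) (g₁ : Z₁ ⟶ Spec (.of S)) (τ : Z' ⟶ Z₁) (z₁ : Z₁)
      (hz₁ : IsClosed ({z₁} : Set Z₁)), IsResolution g₁ → ringKrullDim (Z₁.presheaf.stalk z₁) = 2 →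
      IsBlowup τ (vanishingIdeal ⟨{z₁}, hz₁⟩) → ∀ h : Z' ⟶ Xr, h ≫ πr = τ ≫ g₁ →
        ∃ h₁ : Z₁ ⟶ Xr, τ ≫ h₁ = h ∧ h₁ ≫ πr = g₁ := by
  intro Z₁ Z' g₁ τ z₁ hz₁ hg₁ hz2 hτ h hh
  haveI : IsIntegral Z₁ := hg₁.isIntegral_source
  haveI : IsIntegral Xr := hπr.isIntegral_source
  haveI : IsProper g₁ := hg₁.isProper
  haveI : IsProper πr := hπr.isProper
  haveI : IsLocallyNoetherian Z₁ := LocallyOfFiniteType.isLocallyNoetherian g₁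
  haveI : IsLocallyNoetherian Xr := LocallyOfFiniteType.isLocallyNoetherian πr
  haveI : IsRegularLocalRing (Z₁.presheaf.stalk z₁) := hg₁.isRegular z₁
  have hbg : IsResolution (τ ≫ g₁) := isResolution_blowup_point_comp g₁ hg₁ hz₁ hz2 τ hτ
  haveI : IsIntegral Z' := hbg.isIntegral_source
  haveI : IsProper (τ ≫ g₁) := hbg.isProper
  haveI : IsLocallyNoetherian Z' := LocallyOfFiniteType.isLocallyNoetherian (τ ≫ g₁)
  -- the exceptional curve of `τ`: first kind, regular
  obtain ⟨ε, hε, hcl, hId⟩ := exists_mem_excCurvePoints_blowup_point h2 g₁ hg₁ hz₁ hz2 τ hτ hbg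
  have hnum : h0 (τ ≫ g₁) (primeDivisorIdeal ε ^ 2) = 3 * h0 (τ ≫ g₁) (primeDivisorIdeal ε) := by
    rw [hId]
    exact PointBlowup.h0_comap_vanishingIdeal_point_sq_eq_three_mul g₁ τ z₁ hz₁ hz2 hτ
  have hreg : ∀ t : Z', ε ⤳ t → ¬ stalkIdeal (primeDivisorIdeal ε) t ≤ maximalIdeal (Z'.presheaf.stalk t) ^ 2 :=
    fun t ht => PointBlowup.not_stalkIdeal_primeDivisorIdeal_le_sq hg₁.isRegular z₁ hz₁ hτ hId ht
  -- `h` as a morphism of desingularizations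
  have hres : IsResolution (h ≫ πr) := by rw [hh]; exact hbg
  obtain ⟨-, hbir⟩ := isProper_and_isBirational_of_comp πr h hres hπr
  haveI : IsDominant h := hbir.isDominant
  have hover : πr.base (h.base ε) = closedPoint S := by
    have := hε.1
    rw [← hh] at this
    exact this
  -- the image of `ε` is a closed point
  have hclosed : IsClosed ({h.base ε} : Set Xr) := by
    rcases hπr.mem_excCurvePoints_or_isClosed h2 hover with hexc | hcl'
    · exfalso
      have hM := NoZeno.FirstKind.criterionM_of_forall_isIso h271 h2 hS hπr hrel (h.base ε) hexc
      have hε' : ε ∈ excCurvePoints (h ≫ πr) := by rw [hh]; exact hε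
      have hfk : h0 (h ≫ πr) (primeDivisorIdeal ε ^ 2) = 3 * h0 (h ≫ πr) (primeDivisorIdeal ε) := by
        rw [hh]; exact hnum
      exact false_of_firstKind_of_three_mul_h0_lt Lipman12B.Lipman1969_13_1_d_rat_holds Lipman1969_15_a_holds
        h2 hS hπr h hbir hres hexc hε' hM hfk hreg
    · exact hcl'
  -- so `h` is constant on the fibre `τ⁻¹(z₁) = cl{ε}`, and the rigidity (D1) applies
  have hcontr : ∀ e : Z', τ.base e = z₁ → h.base e = h.base ε := by
    intro e he
    have he' : e ∈ closure ({ε} : Set Z') := by rw [hcl]; exact he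
    have hsp : h.base ε ⤳ h.base e := (specializes_iff_mem_closure.mpr he').map h.base.hom.continuous
    have hmem : h.base e ∈ closure ({h.base ε} : Set Xr) := specializes_iff_mem_closure.mp hsp
    rw [hclosed.closure_eq] at hmem
    exact hmem
  exact exists_fac_of_forall_base_eq g₁ hg₁ τ hz₁ hz2 hτ πr hπr h hh hcontr

/-- **A two-dimensional Noetherian local normal domain with a rational singularity has a MINIMAL desingularization —
from Lipman (27.1) alone.**  This is the consumed form `Lipman1969_4_1.exists_isMinimalResolution_Spec` of the W3 print
`Lipman1969_4_1`, now a consequence of `Lipman1969_27_1_reg_rat`: a desingularization exists (Definition (1.1)); it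
dominates a relatively minimal one (`FirstKind.exists_forall_isIso_of_hasResolution`, hand 18 g1); and a relatively minimal
desingularization is minimal by the descent (D) (`isMinimalResolution_of_descent` + `descent_of_27_1`).
[cite: Lipman1969, Theorem (4.1) (p. 204), Theorem (27.1) (p. 275), Corollary (27.3) (pp. 277–278)] -/
theorem exists_isMinimalResolution_of_27_1 (h271 : Lipman1969_27_1_reg_rat.{0}) (h2 : ringKrullDim S = 2)
    (hS : HasRationalSingularity S) :
    ∃ (X : Scheme.{0}) (f : X ⟶ Spec (.of S)), IsMinimalResolution f :=
  exists_isMinimalResolution_of_descent_of_hasRationalSingularity h2 hS fun _ _ hπr hrel =>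
    descent_of_27_1 h271 h2 hS hπr hrel

omit [CommRing S] [IsNoetherianRing S] [IsLocalRing S] [IsDomain S] [IsIntegrallyClosed S] in
/-- **The named fact `Lipman1969_27_3_rat` (universe `0`) follows from `Lipman1969_27_1_reg_rat` ALONE** (hand 18 g1's
`Lipman1969_27_3_rat_of_27_1_of_exists_minimal` with the local existence of minimal desingularizations discharged by
`exists_isMinimalResolution_of_27_1`). [cite: Lipman1969, Corollary (27.3) (p. 277), Theorem (27.1) (p. 275)] -/
theorem Lipman1969_27_3_rat_of_27_1 (h271 : Lipman1969_27_1_reg_rat.{0}) : Lipman1969_27_3_rat.{0} :=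
  NoZeno.FirstKind.Lipman1969_27_3_rat_of_27_1_of_exists_minimal h271
    fun _ _ _ _ _ _ h2 hS => exists_isMinimalResolution_of_27_1 h271 h2 hS

/-! ## Appendix (same hand): Lipman (27.3) and «relatively minimal ⟺ minimal», both from (27.1) alone -/

/-- **Lipman (27.3), both directions, from (27.1) ALONE** at a desingularization `π` of a rational `S`:
`IsMinimalResolution π ↔ (M)` (hand 18 g1's `isMinimalResolution_iff_criterionM_of_27_1_of_exists` with the existence of a
minimal desingularization supplied by `exists_isMinimalResolution_of_27_1`).
[cite: Lipman1969, Corollary (27.3) (p. 277), Theorem (27.1) (p. 275)] -/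
theorem isMinimalResolution_iff_criterionM_of_27_1 (h271 : Lipman1969_27_1_reg_rat.{0}) (h2 : ringKrullDim S = 2)
    (hS : HasRationalSingularity S) {X : Scheme.{0}} {π : X ⟶ Spec (.of S)} (hπ : IsResolution π) :
    IsMinimalResolution π ↔
      ∀ η ∈ excCurvePoints π, 3 * h0 π (primeDivisorIdeal η) < h0 π (primeDivisorIdeal η ^ 2) :=
  NoZeno.FirstKind.isMinimalResolution_iff_criterionM_of_27_1_of_exists h271 h2 hS
    (exists_isMinimalResolution_of_27_1 h271 h2 hS) hπ

/-- **Relatively minimal ⟺ minimal, from (27.1)** (hand 18 g1's `isMinimalResolution_iff_forall_isIso` with the existence of a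
minimal desingularization supplied by `exists_isMinimalResolution_of_27_1`). [cite: Lipman1969, Corollary (27.3), proof ¶1 (p. 277)] -/
theorem isMinimalResolution_iff_forall_isIso_of_27_1 (h271 : Lipman1969_27_1_reg_rat.{0}) (h2 : ringKrullDim S = 2)
    (hS : HasRationalSingularity S) {X : Scheme.{0}} {π : X ⟶ Spec (.of S)} (hπ : IsResolution π) :
    IsMinimalResolution π ↔
      ∀ (X' : Scheme.{0}) (f' : X' ⟶ Spec (.of S)) (k' : X ⟶ X'), IsResolution f' → k' ≫ f' = π → IsIso k' :=
  NoZeno.FirstKind.isMinimalResolution_iff_forall_isIso (exists_isMinimalResolution_of_27_1 h271 h2 hS) hπ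

end Summit.ResolutionOfSingularities.ResolutionOfSingularities.Theorems.NoZeno.ExcCount.FirstKind

end
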